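import Summits.QuantumFields.BalabanUV.T4Continuum.Support.NE7EnergyRateWGeneric
import HarnessLib

/-!
# NE7EnergyRateWOfDecomposition — NODE NE3's RE-TYPED ROOT T-E_w♯ FOR ANY LETTERED CHART DECOMPOSITION (d = 4, L = 2, any U(card n) modulo the
# class slice-Poincaré): gen 105's `NE7EnergyRateWGeneric.ne3EnergyRateWSup_of_classPoincare` with the pair decomposition of `NE7PairDecompNL0` DISPLAYED
# as a hypothesis instead of produced — the rate holds for EVERY decomposition with the letters, not only for the one the slice theorem constructs

Cell `pub-balaban`, rung (B)+1 sub-cell t4, lineage `b2b-balaban-t4-ne7-p1`, generation 106 (CRUX PROVER NE7 #1 = OWNER of BINDER row NE7).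
Memo `t4/b2b-balaban-t4-ne7-p1-g106/ROAD-G106.md` §4.
WHY.  The supplier line for the regularity half of socket `h′` (memo §4: a sup-norm twin of the (R1″) slice theorem) constructs a chart representative
`X′` of `U_A` relative to `W = cavg 2 U_B` with pointwise letters; to feed the END it must ALSO carry the energy rate (E).  Gen 105 proved (E) for the
representative produced by `decomp_of_nl0_pair`; identifying the two would need CHART INJECTIVITY (the «exactly one u» clause of [Balaban1985RegularSpaces]
Thm 2 for our chart), which is not in the tree.  THIS FILE removes that need: the rate argument is re-run with the decomposition as a HYPOTHESIS.
WHAT ([folklore]; 0 def, 0 sorry).  **`energyRateW_of_decomposition`** — statement in its docstring; proof = gen 105's, verbatim after the decomposition.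
HONEST FRAMING (page 1): composition of landed kernel theorems of rows NE3 and NE7 and [B7]∕[B8]∕[B11] AS TYPED; the class Poincaré is DISPLAYED (a theorem
at `card n = 2, 3`); nothing of Bałaban's asserted as an axiom; NOT NE3∕NE7 as spine nodes; NOT infinite volume, NOT mass gap, NOT BetaPertH, NOT Clay.
-/

set_option autoImplicit false

open scoped BigOperators Matrix Matrix.Norms.L2Operator
open NormedSpace Finset Set

namespace Summit.QuantumFields.BalabanUV.T4Continuum.NE7EnergyRateWOfDecomposition

open Literature.MathematicalPhysics.QuantumFieldTheory.Balaban1983to89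
open B7Prop1Explicit B7Prop2Explicit
open T4AveragingDeficitWall (IsUnitaryCfg IsSkewDir SmallField fineAction vary curl curlSq dirSq)
open T4AveragingDeficitWallBoundary (IsPeriodicCfg periodBox)
open T4ConvexResponse (taylor_lower)
open AveragingDeficitPeriodicCounting (IsPeriodicDir)
open AveragingDeficitDerivWallProof (wallConst wallConst_nonneg)
open AveragingDeficitCoreAxial (coreC_nonneg)
open AveragingDeficitDualResidual (dualC2 dualC1)
open AveragingDeficitChartCalculus (cavg)
open AveragingDeficitTwoLevelPrep (prop1Radius smallField_cavg)
open AveragingDeficitFermat (isPeriodicCfg_cavg)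
open AveragingDeficitMultiLevelPrep (LevelSmall tower)
open AveragingDeficitMultiLevelBridge (cavg_eq_rescale_bavg)
open MinimalActionLevels (perWin levelAction avgIter_rescale_bavg stepWt_pos)
open MinimalActionSandwich (IsMinimiser admissible)
open MinimalActionRate (sfClass Regular)
open NE3HessForm (dAction hess segment_derivData)
open NE3SlicePoincareBudgetLine (CPLine)
open NE3ClassRadiusFamily (CPLine_nonneg_d4_L2)
open NE3EnergyShapes (IsUnitarySite IsPeriodicSite residualScale residualScale_nonneg dualC1_nonneg dualC2_nonneg)
open NE3EnergyWeightedShapes (energyNormW energyNormW_nonneg)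
open NE3EnergyWeightedSupShape (NE3EnergyRateWSup)
open NE3WeightedCoercivityTransfer (energyNormW_sq)
open NE3ProductPathBounds (energyNormW_sub_le)
open NE3EnergyChartLeaves (isUnitaryCfg_cavg_of_regular)
open NE3RightInverseSupLetters (frameC)
open NE3AxialGaugeLadder (smallField_gaugeAct)
open NE7MeanZeroGaugeSliceW (energyBlockLandauW)
open NE7EnergyBlockLandauClassPoincare (classSlicePoincare_energyBlockLandau_SU2)
open NE7ConvOneStepSU2 (levelSmall_all_d4_L2)
open NE7ConvOneStepWeighted (curlSq_ge_weighted hess_vary_ge_weighted)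
open NE7SegmentPlaquetteRadius (smallField_vary_segment_class)
open NE7OneStepLetters (abs_dAction_le_radius_mul)
open NE7ExactCurrent (dAction_add)
open NE7EtaMinimiserGaugeCovariance (levelAction_gaugeAct)
open NE7RepWGaugeOfRoutePi (exp_term_le_of_currency)
open NE7HintUnconditionalSU2 (line_of_small)
open NE7EnergyRateWGeneric (line_of_small_card kfree_coercivity_card)
open NE7EnergySliceSpikeResidual (energyNormW_spike_sq_le spike_tangent_data abs_dAction_le_of_regular_slice)
open BlockAveragePushDirGauge (gaugeDir)
open NE3CornerSpikes (spikeW)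
open NE3TangentCovariantTower (framePotW)

open NE7EnergyRateWPrep (wallConst_pos dualC2_pos_d4 residualScale_lower_d4 cavg_admissible_d4 spike_coef_le spike_energy_le two_sided_ineq rate_algebra ratio_le_of_lower)

noncomputable section

/-- **T-E_w♯ FOR ANY LETTERED CHART DECOMPOSITION** (`d = 4`, `L = 2`, any `U(card n)` modulo the class slice-Poincaré `hPclass` of `𝒯_E`): for the
k-free letters `C_S > 0`, `ν_c, κ_c ≥ 0` there is `ε₀ > 0` such that for `0 < ε ≤ ε₀`, `0 ≤ b`, `b + 10⁸b² ≤ ε`, `g > 0` there are `C, s ≥ 0` (k-free, N-free) with: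
for every level-`(j+1)` minimiser `U_A` and `Regular b g` level-`(j+2)` minimiser `U_B` of the same datum, and EVERY decomposition `U_A^{u} = (cavg 2 U_B)·e^{X}`,
`X = X_T + X_N`, `X_T ∈ 𝒯_E(cavg 2 U_B)`, with the letters of `NE7PairDecompNL0.decomp_of_nl0_pair` (sup `α` with `α·2^{j+1} ≤ C_Sε`, frame letter, `ν ≤ ν_cε`,
`κ ≤ κ_cε`), the weighted energy of THAT `X` obeys `energyNormW ≤ C·residualScale 4 2 N b g (j+1)` and `‖X‖ ≤ s·2^{−(j+1)}`.  This is gen 105's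
`NE7EnergyRateWGeneric.ne3EnergyRateWSup_of_classPoincare` with the decomposition DISPLAYED instead of produced — its proof never used how `X` was obtained
(minimality of `U_A` against the admissible `W`, the letters, (RES♯), the spike transfer, the k-free line) — so a supplier that constructs a chart
representative with EXTRA pointwise letters ((Lip₁ᶜ), (Höl½ᶜ)) inherits the RATE for the same `X` with no chart-injectivity argument. [folklore] -/
theorem energyRateW_of_decomposition {n : Type} [Fintype n] [DecidableEq n] [Nonempty n] {CP₀ ε₁ : ℝ} (hCP₀0 : 0 ≤ CP₀) (hε₁ : 0 < ε₁)
    (hε₁11 : ε₁ ≤ 1 / 10 ^ 11)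
    (hPclass : ∀ (N : ℕ) [NeZero N], 1 ≤ N → ∀ ε : ℝ, 0 < ε → ε ≤ ε₁ → ∀ (j : ℕ) (W : Site 4 → Fin 4 → (Matrix n n ℂ)ˣ),
      W ∈ sfClass 4 2 N ε (j + 1) →
        NE3SlicePoincareShape.SlicePoincare 2 (j + 1) W (energyBlockLandauW (d := 4) (n := n) 2 N (j + 1) W) CP₀ (periodBox (d := 4) (N * 2 ^ (j + 1))))
    {CS νc κc : ℝ} (hCS : 0 < CS) (hνc : 0 ≤ νc) (hκc : 0 ≤ κc) :
    ∃ ε₀ : ℝ, 0 < ε₀ ∧ ∀ ε : ℝ, 0 < ε → ε ≤ ε₀ → ∀ b g : ℝ, 0 ≤ b → b + 10 ^ 8 * b ^ 2 ≤ ε → 0 < g →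
      ∃ C s : ℝ, 0 ≤ C ∧ 0 ≤ s ∧ ∀ (N : ℕ) [NeZero N] (V : Site 4 → Fin 4 → (Matrix n n ℂ)ˣ) (j : ℕ)
        (UA UB : Site 4 → Fin 4 → (Matrix n n ℂ)ˣ),
        IsMinimiser 4 (sfClass 4 2 N ε) 2 N (j + 1) V UA → IsMinimiser 4 (sfClass 4 2 N ε) 2 N (j + 2) V UB → Regular 4 2 N b g (j + 2) UB →
        -- ANY chart decomposition of `U_A` relative to `W = cavg 2 U_B` with the letters of `NE7PairDecompNL0.decomp_of_nl0_pair`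
        ∀ (u : Site 4 → (Matrix n n ℂ)ˣ) (X XT XN : Site 4 → Fin 4 → Matrix n n ℂ) (α ν κ : ℝ),
          IsUnitarySite u → IsPeriodicSite u ((N * 2 ^ (j + 1) : ℕ) : ℤ) → IsSkewDir X → IsPeriodicDir X ((N * 2 ^ (j + 1) : ℕ) : ℤ) → 0 ≤ α →
          (∀ x μ, ‖X x μ‖ ≤ α) → gaugeAct u UA = vary (cavg 2 UB) X 1 → X = XT + XN →
          XT ∈ energyBlockLandauW (d := 4) (n := n) 2 N (j + 1) (cavg 2 UB) →
          (∀ z : Site 4, ‖framePotW 2 (j + 1) (cavg 2 UB) XT z‖ ≤ frameC 4 2 * (CS * ε)) → IsSkewDir XN → 0 ≤ ν →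
          energyNormW 2 (j + 1) (cavg 2 UB) XN (periodBox (d := 4) (N * 2 ^ (j + 1)))
            ≤ ν * energyNormW 2 (j + 1) (cavg 2 UB) X (periodBox (d := 4) (N * 2 ^ (j + 1))) →
          ε / (((2 : ℕ) : ℝ) ^ (j + 1)) ^ 2 * (∑ p ∈ perWin 4 (N * 2 ^ (j + 1)), ‖curl (cavg 2 UB) XN p‖)
            ≤ κ * energyNormW 2 (j + 1) (cavg 2 UB) X (periodBox (d := 4) (N * 2 ^ (j + 1))) ^ 2 →
          α * ((2 : ℕ) : ℝ) ^ (j + 1) ≤ CS * ε → ν ≤ νc * ε → κ ≤ κc * ε →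
          energyNormW 2 (j + 1) (cavg 2 UB) X (periodBox (d := 4) (N * 2 ^ (j + 1))) ≤ C * residualScale 4 2 N b g (j + 1) ∧
          ∀ (x : Site 4) (κ' : Fin 4), ‖X x κ'‖ ≤ s * (((2 : ℕ) : ℝ)⁻¹) ^ (j + 1) := by
  -- the k-free coercivity budget (`line_of_small_card`), Poincaré constant `CP = CP₀ + 1`, `c = card n`
  obtain ⟨c, hc⟩ : ∃ c : ℝ, c = (Fintype.card n : ℝ) := ⟨_, rfl⟩
  have hc1 : 1 ≤ c := by rw [hc]; exact_mod_cast Fintype.card_pos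
  have hc0 : 0 < c := by linarith
  obtain ⟨CP, hCP⟩ : ∃ CP : ℝ, CP = CP₀ + 1 := ⟨_, rfl⟩
  have hCP1 : 1 ≤ CP := by rw [hCP]; linarith
  have hCP0 : 0 ≤ CP := by linarith
  obtain ⟨Q, hQ⟩ : ∃ Q : ℝ, Q = 2 * (1 + CP) := ⟨_, rfl⟩
  have hQ4 : 4 ≤ Q := by rw [hQ]; linarith
  have hQ0 : 0 < Q := by linarith
  obtain ⟨cL, hcL⟩ : ∃ cL : ℝ, cL = 2 * κc + νc ^ 2 + 2304 * (CS ^ 2 * Real.exp (2 * CS)) + 112 * (1 + 7 * CS ^ 2) + 1 := ⟨_, rfl⟩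
  have hcL0 : 0 < cL := by rw [hcL]; positivity
  obtain ⟨ε₃, hε₃⟩ : ∃ ε₃ : ℝ, ε₃ = (1 / 2) / Q / 4 / c / cL := ⟨_, rfl⟩
  have hε₃0 : 0 < ε₃ := by rw [hε₃]; positivity
  refine ⟨min ε₁ (min ε₃ 1), lt_min hε₁ (lt_min hε₃0 one_pos), ?_⟩
  intro ε hε hεle b g hb hbq hg
  have hε53 : ε ≤ ε₁ := hεle.trans (min_le_left _ _)
  have hεε₃ : ε ≤ ε₃ := hεle.trans ((min_le_right _ _).trans (min_le_left _ _))
  have hε1 : ε ≤ 1 := hεle.trans ((min_le_right _ _).trans (min_le_right _ _))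
  have hε11 : ε ≤ 1 / 10 ^ 11 := hε53.trans hε₁11
  -- the strict line: `2κ_c ε < cK`, i.e. the gap `γ := cK/2 − κ_c ε > 0`
  have hsmall : cL * ε ≤ (1 / 2) / Q / 4 / c := by
    have h1 : cL * ε ≤ cL * ε₃ := mul_le_mul_of_nonneg_left hεε₃ hcL0.le
    have h2 : cL * ε₃ = (1 / 2) / Q / 4 / c := by rw [hε₃]; field_simp
    linarith only [h1, h2]
  have hline := line_of_small_card hQ4 hc1 hCS hε hε1 (by rw [← hcL]; exact hsmall)
  obtain ⟨cK, hcK⟩ : ∃ cK : ℝ, cK = ((((1 / 2 - (νc * ε) ^ 2) / Q - (νc * ε) ^ 2) / 2 - 576 * ((4 : ℕ) : ℝ) * ((CS * ε) ^ 2 * Real.exp (2 * (CS * ε)))) / c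
      - 28 * ((4 : ℕ) : ℝ) * (ε + 7 * (CS * ε) ^ 2)) := ⟨_, rfl⟩
  rw [← hcK] at hline
  obtain ⟨γ, hγ⟩ : ∃ γ : ℝ, γ = cK / 2 - κc * ε := ⟨_, rfl⟩
  have hγ0 : 0 < γ := by rw [hγ]; linarith
  -- the constants of the bound
  obtain ⟨C', hC'⟩ : ∃ C' : ℝ, C' = (Real.sqrt (((2 : ℕ) : ℝ) ^ (4 - 2))
            + (Real.sqrt (((2 : ℕ) : ℝ) ^ (4 - 2)) * Real.sqrt (8 * Fintype.card (T4AveragingDeficitWall.Plane 4))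
                * (128 * ((4 : ℕ) * ((2 : ℕ) : ℝ) ^ 2))
              + 2 * (2048 * (((4 : ℕ) : ℝ) + 4) ^ 2 * ((2 : ℕ) : ℝ) ^ 2 * Real.sqrt ((4 : ℕ) * ((2 : ℕ) : ℝ) ^ 4))) * b
            + b ^ 2 * (2 * ((2 : ℕ) : ℝ) ^ (4 - 1) + 2 * (8 * (4 : ℕ) * ((2 : ℕ) : ℝ) ^ 4)) * Real.sqrt ((4 : ℕ) / (g * ((2 : ℕ) : ℝ) ^ (4 + 2)))) := ⟨_, rfl⟩
  have hC'0 : 0 ≤ C' := by rw [hC']; positivity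
  obtain ⟨G, hG⟩ : ∃ G : ℝ, G = frameC 4 2 * (CS * ε) := ⟨_, rfl⟩
  have hG0 : 0 ≤ G := by rw [hG]; have := NE7FrameFreeRightInverse.frameC_nonneg 4 2; positivity
  obtain ⟨σ, hσ⟩ : ∃ σ : ℝ, σ = Real.sqrt (4 * (Fintype.card (T4AveragingDeficitWall.Plane 4) : ℝ) + 16) * G := ⟨_, rfl⟩
  have hσ0 : 0 ≤ σ := by rw [hσ]; positivity
  obtain ⟨w₀, hw₀⟩ : ∃ w₀ : ℝ, w₀ = wallConst 4 2 * dualC2 4 2 * Real.sqrt g := ⟨_, rfl⟩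
  have hw₀0 : 0 < w₀ := by rw [hw₀]; exact mul_pos (mul_pos (wallConst_pos 4 2) dualC2_pos_d4) (Real.sqrt_pos.2 hg)
  obtain ⟨Cfin, hCfin⟩ : ∃ Cfin : ℝ, Cfin = C' * (1 + νc * ε) / γ + Real.sqrt (2 * C' * σ / (γ * w₀)) := ⟨_, rfl⟩
  refine ⟨Cfin, CS * ε, by rw [hCfin]; positivity, by positivity, ?_⟩
  intro N _ V j UA UB hA hB' hreg' u X XT XN α ν κ hu huP hXs hXP hα hXα hgauge hXdec hXT hframe hXN hν hNw hN1 hαM hνle hκle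
  have hN : 1 ≤ N := Nat.one_le_iff_ne_zero.mpr (NeZero.ne N)
  -- the competitor `W := cavg 2 U_B` and its class data
  obtain ⟨hbε, hs1, hs2, hWu, hWP, hWx, hWadm⟩ := cavg_admissible_d4 (N := N) j hε hε11 hb hbq hB' hreg'
  have htow : ((tower 2 N (j + 1) : ℕ) : ℤ) = ((N * 2 ^ (j + 1) : ℕ) : ℤ) := by rw [NE3EnergyRateWSupOfSlicePoincare.tower_eq_mul_pow]
  have hWPt : IsPeriodicCfg (cavg 2 UB) ((tower 2 N (j + 1) : ℕ) : ℤ) := by rw [htow]; exact hWP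
  have hM0 : (0 : ℝ) < ((2 : ℕ) : ℝ) ^ (j + 1) := by positivity
  have hM1 : (1 : ℝ) ≤ ((2 : ℕ) : ℝ) ^ (j + 1) := one_le_pow₀ (by norm_num)
  have hx : 0 ≤ ε / (((2 : ℕ) : ℝ) ^ (j + 1)) ^ 2 := by positivity
  have hE0 := energyNormW_nonneg 2 (j + 1) (cavg 2 UB) X (periodBox (d := 4) (N * 2 ^ (j + 1)))
  -- (1) the weighted Poincaré letter on the class (constant `CP₀ ≤ CP`)
  have hP0 := hPclass N hN ε hε hε53 j (cavg 2 UB) ⟨hWu, hWP, hWx⟩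
  have hP := NE3SlicePoincareShape.slicePoincare_mono hP0 (show CP₀ ≤ CP by rw [hCP]; linarith)
  have hNw2 : energyNormW 2 (j + 1) (cavg 2 UB) XN (periodBox (d := 4) (N * 2 ^ (j + 1))) ^ 2
      ≤ ν ^ 2 * energyNormW 2 (j + 1) (cavg 2 UB) X (periodBox (d := 4) (N * 2 ^ (j + 1))) ^ 2 := by
    have h0 := energyNormW_nonneg 2 (j + 1) (cavg 2 UB) XN (periodBox (d := 4) (N * 2 ^ (j + 1)))
    calc _ ≤ (ν * energyNormW 2 (j + 1) (cavg 2 UB) X (periodBox (d := 4) (N * 2 ^ (j + 1)))) ^ 2 := pow_le_pow_left₀ h0 hNw 2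
      _ = _ := by ring
  have hm := curlSq_ge_weighted (L := 2) (k := j + 1) hCP0 hP hXdec hXT hNw2
  -- (2) the plaquette radius along the segment, (3) the convexity letter
  have h1 : SmallField (vary (cavg 2 UB) X 1) (ε / (((2 : ℕ) : ℝ) ^ (j + 1)) ^ 2) := by
    rw [← hgauge]; exact smallField_gaugeAct hu hA.mem.1.2.2
  have hrad : ∀ t ∈ Icc (0 : ℝ) 1, SmallField (vary (cavg 2 UB) X t) (ε / (((2 : ℕ) : ℝ) ^ (j + 1)) ^ 2 + 7 * α ^ 2) := fun t ht =>
    smallField_vary_segment_class hWu hXs hWx h1 hXα ht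
  have ha' : 0 ≤ ε / (((2 : ℕ) : ℝ) ^ (j + 1)) ^ 2 + 7 * α ^ 2 := by positivity
  have hNM : 1 ≤ N * 2 ^ (j + 1) := Nat.mul_pos (by omega) (Nat.pow_pos (by norm_num))
  have hconv : ∀ t ∈ Icc (0 : ℝ) 1,
      ((((1 / 2 - ν ^ 2) / (2 * (1 + CP)) - ν ^ 2) / 2 - 576 * ((4 : ℕ) : ℝ) * (Real.exp α - 1) ^ 2 * (((2 : ℕ) : ℝ) ^ (j + 1)) ^ 2)
            / (Fintype.card n : ℝ)
          - 28 * ((4 : ℕ) : ℝ) * (ε / (((2 : ℕ) : ℝ) ^ (j + 1)) ^ 2 + 7 * α ^ 2) * (((2 : ℕ) : ℝ) ^ (j + 1)) ^ 2)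
          * energyNormW 2 (j + 1) (cavg 2 UB) X (periodBox (d := 4) (N * 2 ^ (j + 1))) ^ 2
        ≤ hess (vary (cavg 2 UB) X t) X X (perWin 4 (N * 2 ^ (j + 1))) := fun t ht =>
    hess_vary_ge_weighted (d := 4) (L := 2) (k := j + 1) (le_refl 1 |>.trans one_le_two) hNM hWu hXs hXP hα hXα hm ht ha' (hrad t ht)
  -- the k-free minorant `cK ≤ c_k`
  have hck : cK ≤ ((((1 / 2 - ν ^ 2) / (2 * (1 + CP)) - ν ^ 2) / 2 - 576 * ((4 : ℕ) : ℝ) * (Real.exp α - 1) ^ 2 * (((2 : ℕ) : ℝ) ^ (j + 1)) ^ 2)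
            / (Fintype.card n : ℝ)
          - 28 * ((4 : ℕ) : ℝ) * (ε / (((2 : ℕ) : ℝ) ^ (j + 1)) ^ 2 + 7 * α ^ 2) * (((2 : ℕ) : ℝ) ^ (j + 1)) ^ 2) := by
    rw [← hc, hcK, hQ]
    exact kfree_coercivity_card hc0 hCP0 hM1 hν hνle hα hαM
  -- (4) Taylor along the segment and (5) minimality of `U_A` against the admissible `W`
  obtain ⟨hd1, hd2⟩ := segment_derivData (cavg 2 UB) X (perWin 4 (N * 2 ^ (j + 1)))
  have htaylor := taylor_lower hd1 hd2 (fun t ht => (mul_le_mul_of_nonneg_right hck (sq_nonneg _)).trans (hconv t ht))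
  rw [T4AveragingDeficitWall.vary_zero] at htaylor
  have hmin : fineAction (vary (cavg 2 UB) X 1) (perWin 4 (N * 2 ^ (j + 1))) ≤ fineAction (cavg 2 UB) (perWin 4 (N * 2 ^ (j + 1))) := by
    have hle := hA.le (cavg 2 UB) hWadm
    rw [← levelAction_gaugeAct 2 N (j + 1) u UA, hgauge] at hle
    unfold levelAction at hle
    have hw : 0 < ((MinimalActionLevels.stepWt 4 2)⁻¹) ^ (j + 1) := pow_pos (inv_pos.mpr (stepWt_pos (d := 4) 2 (by norm_num))) _
    exact le_of_mul_le_mul_left hle hw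
  -- (6) the split of the first variation: the normal part's curl letter
  have hsplit : dAction (cavg 2 UB) X (perWin 4 (N * 2 ^ (j + 1)))
      = dAction (cavg 2 UB) XT (perWin 4 (N * 2 ^ (j + 1))) + dAction (cavg 2 UB) XN (perWin 4 (N * 2 ^ (j + 1))) := by
    conv_lhs => rw [hXdec]
    exact dAction_add _ _ _ _
  have hNpart : |dAction (cavg 2 UB) XN (perWin 4 (N * 2 ^ (j + 1)))| ≤ κ * energyNormW 2 (j + 1) (cavg 2 UB) X (periodBox (d := 4) (N * 2 ^ (j + 1))) ^ 2 :=
    (abs_dAction_le_radius_mul hWu hXN hWx (perWin 4 (N * 2 ^ (j + 1)))).trans hN1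
  -- (7)–(8) (RES♯) on the slice part, with the spike's weighted energy
  have hres := abs_dAction_le_of_regular_slice (n := n) (d := 4) (by norm_num) (le_refl 1 |>.trans one_le_two) hN j hb hbε hg hs2 hB' hreg'
    hWu hWPt hx hs1 hWx hXT
  obtain ⟨-, -, -, hfP, -⟩ := spike_tangent_data (N := N) (le_refl 1 |>.trans one_le_two) j hWu hWPt hx hs1 hWx hXT
  have hS2 := energyNormW_spike_sq_le (d := 4) (le_refl 1 |>.trans one_le_two) hN j hWu hWx hfP hframe
  have hES0 := energyNormW_nonneg 2 (j + 1) (cavg 2 UB) (gaugeDir (cavg 2 UB) (spikeW (2 ^ (j + 1)) (framePotW 2 (j + 1) (cavg 2 UB) XT)))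
      (periodBox (d := 4) (N * 2 ^ (j + 1)))
  have hET := energyNormW_sub_le 2 (j + 1) (cavg 2 UB) X XN (periodBox (d := 4) (N * 2 ^ (j + 1)))
  have hXTeq : XT = X - XN := eq_sub_of_add_eq hXdec.symm
  rw [← hXTeq] at hET
  have hρlow := residualScale_lower_d4 N j (b := b) hg.le
  have hρ0 := residualScale_nonneg 4 2 N b g (j + 1)
  -- ABSTRACT THE ATOMS and do the arithmetic with the pure real lemmas of §3b
  set M : ℝ := ((2 : ℕ) : ℝ) ^ (j + 1) with hM
  set E : ℝ := energyNormW 2 (j + 1) (cavg 2 UB) X (periodBox (d := 4) (N * 2 ^ (j + 1))) with hE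
  set ET : ℝ := energyNormW 2 (j + 1) (cavg 2 UB) XT (periodBox (d := 4) (N * 2 ^ (j + 1))) with hETdef
  set EN : ℝ := energyNormW 2 (j + 1) (cavg 2 UB) XN (periodBox (d := 4) (N * 2 ^ (j + 1))) with hENdef
  set ES : ℝ := energyNormW 2 (j + 1) (cavg 2 UB) (gaugeDir (cavg 2 UB) (spikeW (2 ^ (j + 1)) (framePotW 2 (j + 1) (cavg 2 UB) XT)))
      (periodBox (d := 4) (N * 2 ^ (j + 1))) with hESdef
  set ρ : ℝ := residualScale 4 2 N b g (j + 1) with hρ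
  set P : ℝ := (Fintype.card (T4AveragingDeficitWall.Plane 4) : ℝ) with hPdef
  have hP0' : 0 ≤ P := by rw [hPdef]; positivity
  -- `hres` in the abstract currency: `|dAction W X_T| ≤ C'ρ (ET + ES)`
  have hres' : |dAction (cavg 2 UB) XT (perWin 4 (N * 2 ^ (j + 1)))| ≤ C' * ρ * (ET + ES) := by rw [hC']; exact hres
  have hr0 : 0 ≤ C' * ρ := mul_nonneg hC'0 hρ0
  -- the spike's weighted energy: `ES ≤ σ·N²/M`
  have hESle : ES ≤ σ * ((N : ℝ) ^ 2 / M) := by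
    have h := spike_energy_le hES0 hG0 hM0 hP0' (by rw [hG]; exact hS2)
      (spike_coef_le hM1 hε.le hε1 hP0')
    rw [hσ, hPdef]; simpa only [mul_assoc] using h
  -- (9) the two-sided inequality `γ E² ≤ C'ρ(1+ν_c ε)·E + C'ρ·σ·N²/M`
  have hkey : dAction (cavg 2 UB) X (perWin 4 (N * 2 ^ (j + 1))) + cK * E ^ 2 / 2 ≤ 0 := by linarith only [htaylor, hmin]
  have hETle : ET ≤ (1 + νc * ε) * E := by
    have : EN ≤ νc * ε * E := hNw.trans (mul_le_mul_of_nonneg_right hνle hE0)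
    linarith only [hET, this]
  have hTpart : |dAction (cavg 2 UB) XT (perWin 4 (N * 2 ^ (j + 1)))| ≤ C' * ρ * ((1 + νc * ε) * E + σ * ((N : ℝ) ^ 2 / M)) :=
    hres'.trans (mul_le_mul_of_nonneg_left (by linarith only [hETle, hESle]) hr0)
  have hγE : γ * E ^ 2 ≤ C' * ρ * (1 + νc * ε) * E + C' * ρ * (σ * ((N : ℝ) ^ 2 / M)) := by
    rw [hγ]; exact two_sided_ineq hkey hsplit hNpart hTpart hκle
  -- (10) `N²/M ≤ 2ρ/w₀` and the final bookkeeping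
  have hNM' : (N : ℝ) ^ 2 / M ≤ 2 * ρ / w₀ := ratio_le_of_lower hM0 hw₀0 (by rw [hw₀]; exact hρlow)
  have hfinal : E ≤ Cfin * ρ := by
    rw [hCfin]
    exact rate_algebra hρ0 hγ0 hC'0 (by positivity) hσ0 hw₀0 (by positivity) hNM' hγE
  -- (11) the sup letter: `‖X(b)‖ ≤ α ≤ C_S ε / M = (C_S ε)·2^{−(j+1)}`
  have hsup : ∀ (x : Site 4) (κ' : Fin 4), ‖X x κ'‖ ≤ CS * ε * (((2 : ℕ) : ℝ)⁻¹) ^ (j + 1) := by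
    intro x κ'
    have hαle : α ≤ CS * ε / M := by rw [le_div_iff₀ hM0]; exact hαM
    have e : CS * ε * (((2 : ℕ) : ℝ)⁻¹) ^ (j + 1) = CS * ε / M := by rw [inv_pow, hM]; ring
    rw [e]; exact (hXα x κ').trans hαle
  exact ⟨hfinal, hsup⟩



end

end Summit.QuantumFields.BalabanUV.T4Continuum.NE7EnergyRateWOfDecomposition
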